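import Literature.MathematicalPhysics.QuantumFieldTheory.BalabanImbrieJaffe1984to88.BIJ88Sect3Statements

/-!
# `BalabanImbrieJaffe1984to88.BIJ88W0Remainder` — T. Bałaban, J. Imbrie, A. Jaffe, *Effective action and cluster
properties of the abelian Higgs model*, Commun. Math. Phys. **114** (1988) 257–315 [BalabanImbrieJaffe1988]:
Sect. 3 "The First Renormalization Step", display (3.16) p. 267 — the bound on the «irrelevant» remainder `W₀(p)` of
the expansion of the Wilson action `e₀⁻²[1 − Re u(p)]` in powers of `e₀`, and the sign of its polynomial part `V₀(p)`.

statement-level skeleton of published theorems with citation tags; proofs where landed; nothing here is a claim about the Yang–Mills mass gap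

PDF held: `paper:balaban1988-cmp114-bij-abelian-higgs-effective-action` (journal page = PDF page + 256); PDF p. 11 (journal 267)
rendered and read as an image (poppler ×3); the display (3.16) and the sentence following it are quoted below verbatim.

CITATION HEADER (lean-in-tree rule).  lit-balaban TYPED SKELETON, PHASE 2 (HOME `run/shared/lean/pub/lit-balaban/`; proof seat p36 =
unit `lit-balaban-p36`; `PHASE2-TARGETS.md` §G.3 line p36 as RE-POINTED by `PHASE2-PACKETS.md` §p36; statement file of record
`BIJ88Sect3Statements` (unit `lit-balaban-r18`), second reader `lit-balaban-r16`).  WHAT IS REPRODUCED: SKELETON row `C2.Eq3.16`.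
**(3.16)** p. 267, verbatim: *"e₀⁻²[1 − Re u(p)] = ½f^{(0)}(p)² + Σ_{n=2}^{n̄/2} (−1)ⁿ e₀^{2n−2}(f^{(0)}(p))^{2n}/(2n)! + W₀(p) =
½f^{(0)}(p)² + V₀(p) + W₀(p). (3.16)"* and, verbatim: *"We consider the expansion up to order n̄ in e₀ explicitly, the remainder
is called 'irrelevant' because it is bounded by ce₀^{n̄}p(e₀)^{n̄+2} ≦ eε^{d+1} for n̄ large enough."*  Here `u(p) = exp(ie₀f^{(0)}(p))`
((3.15): `f^{(0)}(p) = (ie₀)⁻¹ log u(p)`), so `e₀⁻²[1 − Re u(p)] = e₀⁻²(1 − cos e₀f) = Σ_{n≥1} (−1)^{n+1} e₀^{2n−2} f^{2n}/(2n)!`: the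
PRINTED sign `(−1)ⁿ` of the polynomial part is a slip for `(−1)^{n+1}` (transcript note T1, `HOME/lit-balaban-r18/ROWS-C2.md`; the
decls of record `BIJ88Sect3Statements.V0`/`.W0` keep the printed sign and DEFINE `W₀` as the remainder, so (3.16) `eq316` holds by
definition; v1.2 of that file adds the corrected `V0corr`/`W0corr = W₀ + 2V₀`).  PROVED here (`N = nhalf = n̄/2`; no definitions):
* private kernel: the alternating Taylor bound `|cos x − Σ_{n=0}^{N} (−1)ⁿx^{2n}/(2n)!| ≤ |x|^{2N+2}/(2N+2)!`, all real `x`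
  (monotonicity induction `cos ≤ 1 ⇒ sin x ≤ x ⇒ cos x ≥ 1 − x²/2 ⇒ …` on `[0, ∞)`); public as `cos_taylor_remainder_sharp` (v1.1);
* `W0_add_two_V0_eq`/`W0_add_two_V0_cos_eq`: the corrected remainder is `W₀ + 2V₀`, `= e₀⁻²×`(Taylor polynomial of `cos` − `cos`) at `e₀f`;
* **the p. 267 bound, corrected sign**: `|W₀ + 2V₀| ≤ e₀^{n̄}|f|^{n̄+2}/(n̄+2)!` for `Re u = cos(e₀f)`, ALL real `f`, `e₀ ≠ 0`, `N ∈ ℕ`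
  (`abs_W0_add_two_V0_le`, `abs_remainder316_le`; v1.1: `abs_W0corr_le_sharp`); under (3.15) `|f| ≤ p(e₀)` the printed shape
  `≤ c e₀^{n̄}p(e₀)^{n̄+2}`, `c = 1` (`abs_W0_add_two_V0_le_of_smallField`, `abs_W0corr_le_printed_sharp`); for a plaquette variable
  `|v| = 1`, `f = Re f^{(0)}(v)`, `Re v = cos(e₀f)` (`re_eq_cos_fieldStrength`, `abs_W0_add_two_V0_le_plaquette`);
* **the printed sign is not small** (kernel witness): with `V₀` AS PRINTED, `N = 2`, `f = 1`, `0 < e₀ ≤ 1`: `W₀ ≤ −(59/720)e₀²`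
  (`W0_printed_le`), so NO constant `c` gives `|W₀| ≤ c e₀⁴|f|⁶` on `{0 < e₀ ≤ 1, |f| ≤ 1}` (`W0_printed_sign_not_small`).
The comparison `ce₀^{n̄}p(e₀)^{n̄+2} ≦ eε^{d+1}` (choice of `n̄`; `e₀ = e(ε)`, `p(e₀)` of Sect. 4) is NOT reproduced here.
-/

namespace Literature.MathematicalPhysics.QuantumFieldTheory.BalabanImbrieJaffe1984to88.BIJ88W0Remainder

open Literature.MathematicalPhysics.QuantumFieldTheory.BalabanImbrieJaffe1984to88.BIJ88Sect3Statements
open scoped BigOperators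
open Finset

/-! ## Kernel: the alternating Taylor bounds for `cos` / `sin` -/

/-- kernel (calculus): the Taylor polynomial of `sin` of degree `2N+1` has derivative the Taylor polynomial of `cos` of
degree `2N`: `d/dx Σ_{n≤N} (−1)ⁿx^{2n+1}/(2n+1)! = Σ_{n≤N} (−1)ⁿx^{2n}/(2n)!`. [folklore] -/
private theorem hasDerivAt_sinTaylor (N : ℕ) (x : ℝ) :
    HasDerivAt (fun y : ℝ => ∑ n ∈ range (N + 1), (-1 : ℝ) ^ n * y ^ (2 * n + 1) / ((2 * n + 1).factorial : ℝ))
      (∑ n ∈ range (N + 1), (-1 : ℝ) ^ n * x ^ (2 * n) / ((2 * n).factorial : ℝ)) x := by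
  apply HasDerivAt.fun_sum
  intro n _
  refine (((hasDerivAt_pow (2 * n + 1) x).const_mul ((-1 : ℝ) ^ n)).div_const ((2 * n + 1).factorial : ℝ)).congr_deriv ?_
  rw [Nat.factorial_succ, Nat.add_sub_cancel]
  have h1 : ((2 * n).factorial : ℝ) ≠ 0 := by positivity
  push_cast
  field_simp

/-- kernel (calculus): the Taylor polynomial of `cos` of degree `2N+2` has derivative minus the Taylor polynomial of `sin` of
degree `2N+1`: `d/dx Σ_{n≤N+1} (−1)ⁿx^{2n}/(2n)! = −Σ_{n≤N} (−1)ⁿx^{2n+1}/(2n+1)!`. [folklore] -/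
private theorem hasDerivAt_cosTaylor (N : ℕ) (x : ℝ) :
    HasDerivAt (fun y : ℝ => ∑ n ∈ range (N + 2), (-1 : ℝ) ^ n * y ^ (2 * n) / ((2 * n).factorial : ℝ))
      (-(∑ n ∈ range (N + 1), (-1 : ℝ) ^ n * x ^ (2 * n + 1) / ((2 * n + 1).factorial : ℝ))) x := by
  have h : HasDerivAt (fun y : ℝ => ∑ n ∈ range (N + 2), (-1 : ℝ) ^ n * y ^ (2 * n) / ((2 * n).factorial : ℝ))
      (∑ n ∈ range (N + 2), (-1 : ℝ) ^ n * (((2 * n : ℕ) : ℝ) * x ^ (2 * n - 1)) / ((2 * n).factorial : ℝ)) x := by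
    apply HasDerivAt.fun_sum
    intro n _
    exact ((hasDerivAt_pow (2 * n) x).const_mul ((-1 : ℝ) ^ n)).div_const _
  refine h.congr_deriv ?_
  rw [Finset.sum_range_succ' (fun n => (-1 : ℝ) ^ n * (((2 * n : ℕ) : ℝ) * x ^ (2 * n - 1)) / ((2 * n).factorial : ℝ))]
  simp only [mul_zero, Nat.cast_zero, zero_mul, mul_zero, zero_div, add_zero]
  rw [← Finset.sum_neg_distrib]
  refine Finset.sum_congr rfl fun n _ => ?_
  have e1 : 2 * (n + 1) - 1 = 2 * n + 1 := by omega
  have e2 : (2 * (n + 1)).factorial = (2 * n + 2) * (2 * n + 1).factorial := by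
    rw [show 2 * (n + 1) = (2 * n + 1) + 1 by ring, Nat.factorial_succ]
  rw [e1, e2, pow_succ (-1 : ℝ) n]
  have h1 : ((2 * n + 1).factorial : ℝ) ≠ 0 := by positivity
  have h2 : (2 * (n : ℝ) + 2) ≠ 0 := by positivity
  push_cast
  field_simp

/-- kernel (calculus): a function vanishing at `0` with a derivative that is `≥ 0` on `[0, ∞)` is `≥ 0` on `[0, ∞)`. [folklore] -/
private theorem nonneg_of_hasDerivAt_nonneg {g g' : ℝ → ℝ} (hd : ∀ x, HasDerivAt g (g' x) x)
    (hg' : ∀ x, 0 ≤ x → 0 ≤ g' x) (h0 : g 0 = 0) (x : ℝ) (hx : 0 ≤ x) : 0 ≤ g x := by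
  have hmono : MonotoneOn g (Set.Ici 0) :=
    monotoneOn_of_hasDerivWithinAt_nonneg (convex_Ici 0) (fun y _ => (hd y).continuousAt.continuousWithinAt)
      (fun y _ => (hd y).hasDerivWithinAt) (fun y hy => hg' y (le_of_lt (by simpa [interior_Ici] using hy)))
  simpa [h0] using hmono Set.self_mem_Ici hx hx

/-- kernel (calculus): if the `cos` remainder of order `2N` has the sign `(−1)^{N+1}` on `[0, ∞)`, then so has the `sin`
remainder of order `2N+1` (integrate from `0`). [folklore] -/
private theorem sinTaylor_sign_of_cosTaylor_sign (N : ℕ)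
    (h : ∀ x : ℝ, 0 ≤ x →
      0 ≤ (-1 : ℝ) ^ (N + 1) * (Real.cos x - ∑ n ∈ range (N + 1), (-1 : ℝ) ^ n * x ^ (2 * n) / ((2 * n).factorial : ℝ))) :
    ∀ x : ℝ, 0 ≤ x →
      0 ≤ (-1 : ℝ) ^ (N + 1) * (Real.sin x - ∑ n ∈ range (N + 1), (-1 : ℝ) ^ n * x ^ (2 * n + 1) / ((2 * n + 1).factorial : ℝ)) :=
  nonneg_of_hasDerivAt_nonneg (fun x => ((Real.hasDerivAt_sin x).sub (hasDerivAt_sinTaylor N x)).const_mul _) h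
    (by simp)

/-- kernel (calculus): if the `sin` remainder of order `2N+1` has the sign `(−1)^{N+1}` on `[0, ∞)`, then the `cos` remainder of
order `2N+2` has the sign `(−1)^{N+2}` (integrate from `0`). [folklore] -/
private theorem cosTaylor_sign_succ_of_sinTaylor_sign (N : ℕ)
    (h : ∀ x : ℝ, 0 ≤ x →
      0 ≤ (-1 : ℝ) ^ (N + 1) * (Real.sin x - ∑ n ∈ range (N + 1), (-1 : ℝ) ^ n * x ^ (2 * n + 1) / ((2 * n + 1).factorial : ℝ))) :
    ∀ x : ℝ, 0 ≤ x →
      0 ≤ (-1 : ℝ) ^ (N + 2) * (Real.cos x - ∑ n ∈ range (N + 2), (-1 : ℝ) ^ n * x ^ (2 * n) / ((2 * n).factorial : ℝ)) := by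
  refine nonneg_of_hasDerivAt_nonneg (fun x => ((Real.hasDerivAt_cos x).sub (hasDerivAt_cosTaylor N x)).const_mul _)
    (fun x hx => ?_) (by simp [Finset.sum_range_succ'])
  have e : (-1 : ℝ) ^ (N + 2) *
      (-Real.sin x - -(∑ n ∈ range (N + 1), (-1 : ℝ) ^ n * x ^ (2 * n + 1) / ((2 * n + 1).factorial : ℝ)))
      = (-1 : ℝ) ^ (N + 1) *
        (Real.sin x - ∑ n ∈ range (N + 1), (-1 : ℝ) ^ n * x ^ (2 * n + 1) / ((2 * n + 1).factorial : ℝ)) := by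
    rw [pow_succ]; ring
  rw [e]; exact h x hx

/-- kernel (calculus): for `x ≥ 0` the remainder `cos x − Σ_{n=0}^{N} (−1)ⁿx^{2n}/(2n)!` has the sign `(−1)^{N+1}` of the first
omitted term. [folklore] -/
private theorem cosTaylor_sign : ∀ (N : ℕ) (x : ℝ), 0 ≤ x →
    0 ≤ (-1 : ℝ) ^ (N + 1) * (Real.cos x - ∑ n ∈ range (N + 1), (-1 : ℝ) ^ n * x ^ (2 * n) / ((2 * n).factorial : ℝ))
  | 0, x, _ => by
    have := Real.cos_le_one x
    simp only [zero_add, pow_one, Finset.sum_range_one, pow_zero, mul_zero, Nat.factorial_zero, Nat.cast_one,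
      div_one, mul_one]
    linarith
  | N + 1, x, hx =>
    cosTaylor_sign_succ_of_sinTaylor_sign N (sinTaylor_sign_of_cosTaylor_sign N fun y hy => cosTaylor_sign N y hy) x hx

/-- kernel (plumbing): `(−1)ⁿ·(−1)ⁿ = 1`. [folklore] -/
private theorem neg_one_pow_mul_self (n : ℕ) : (-1 : ℝ) ^ n * (-1 : ℝ) ^ n = 1 := by
  rw [← pow_add, ← two_mul, pow_mul, neg_one_sq, one_pow]

/-- kernel (calculus): the alternating Taylor bound for `cos` on `[0, ∞)`. [folklore] -/
private theorem abs_cos_sub_taylor_le_of_nonneg (N : ℕ) (x : ℝ) (hx : 0 ≤ x) :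
    |Real.cos x - ∑ n ∈ range (N + 1), (-1 : ℝ) ^ n * x ^ (2 * n) / ((2 * n).factorial : ℝ)|
      ≤ x ^ (2 * N + 2) / ((2 * N + 2).factorial : ℝ) := by
  have h1 := cosTaylor_sign N x hx
  have h2 := cosTaylor_sign (N + 1) x hx
  rw [Finset.sum_range_succ, show 2 * (N + 1) = 2 * N + 2 by ring] at h2
  set S := ∑ n ∈ range (N + 1), (-1 : ℝ) ^ n * x ^ (2 * n) / ((2 * n).factorial : ℝ) with hS
  set t := x ^ (2 * N + 2) / ((2 * N + 2).factorial : ℝ) with ht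
  have h2' : 0 ≤ -((-1 : ℝ) ^ (N + 1) * (Real.cos x - S)) + t := by
    have e : (-1 : ℝ) ^ (N + 1 + 1) * (Real.cos x - (S + (-1 : ℝ) ^ (N + 1) * x ^ (2 * N + 2) / ((2 * N + 2).factorial : ℝ)))
        = -((-1 : ℝ) ^ (N + 1) * (Real.cos x - S)) + ((-1 : ℝ) ^ (N + 1) * (-1 : ℝ) ^ (N + 1)) * t := by
      rw [pow_succ, ht]; ring
    rw [e, neg_one_pow_mul_self, one_mul] at h2
    exact h2
  have habs : |Real.cos x - S| = (-1 : ℝ) ^ (N + 1) * (Real.cos x - S) := by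
    rw [← abs_of_nonneg h1, abs_mul, abs_neg_one_pow, one_mul]
  rw [habs]
  linarith

/-- kernel (calculus): **the alternating Taylor bound for `cos`** — for every `N ∈ ℕ` and every real `x`,
`|cos x − Σ_{n=0}^{N} (−1)ⁿ x^{2n}/(2n)!| ≤ |x|^{2N+2}/(2N+2)!` (the remainder is bounded by the modulus of the first omitted
term; Mathlib's `Real.cos_bound` is the case `N = 1` with constant `5/96` on `|x| ≤ 1`). [folklore] -/
private theorem abs_cos_sub_taylor_le (N : ℕ) (x : ℝ) :
    |Real.cos x - ∑ n ∈ range (N + 1), (-1 : ℝ) ^ n * x ^ (2 * n) / ((2 * n).factorial : ℝ)|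
      ≤ |x| ^ (2 * N + 2) / ((2 * N + 2).factorial : ℝ) := by
  have key := abs_cos_sub_taylor_le_of_nonneg N |x| (abs_nonneg x)
  simpa only [Real.cos_abs, pow_mul, sq_abs] using key

/-! ## (3.16): the printed polynomial `V₀`, the corrected sign, and the remainder -/

/-- kernel: `V₀` with upper limit `n̄/2 = 0` or `1` is the empty sum. [cite: BalabanImbrieJaffe1988, (3.16) p.267] -/
theorem V0_of_le_one (e₀ f : ℝ) {N : ℕ} (hN : N ≤ 1) : V0 e₀ N f = 0 := by
  unfold V0
  rw [Finset.Icc_eq_empty (by omega), Finset.sum_empty]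

/-- kernel: the top term of `V₀` — `V₀|_{n̄/2 = N+1} = V₀|_{n̄/2 = N} + (−1)^{N+1} e₀^{2N} f^{2N+2}/(2N+2)!` for `N ≥ 1`.
[cite: BalabanImbrieJaffe1988, (3.16) p.267] -/
theorem V0_succ (e₀ f : ℝ) {N : ℕ} (hN : 1 ≤ N) :
    V0 e₀ (N + 1) f = V0 e₀ N f +
      (-1 : ℝ) ^ (N + 1) * e₀ ^ (2 * (N + 1) - 2) * f ^ (2 * (N + 1)) / ((2 * (N + 1)).factorial : ℝ) := by
  unfold V0
  exact Finset.sum_Icc_succ_top (by omega) _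

/-- **(3.16) p. 267 with the sign of the polynomial part corrected** (`(−1)^{n+1}`, the Taylor coefficients of
`e₀⁻²(1 − cos e₀f)`; the display PRINTS `(−1)ⁿ`, kept by the decl of record `V0`): the remainder of the corrected splitting
`e₀⁻²[1 − Re u] = ½f² + Σ_{n=2}^{n̄/2} (−1)^{n+1} e₀^{2n−2} f^{2n}/(2n)! + (remainder)` equals `W₀ + 2V₀` in terms of the decls of
record (`W0` is DEFINED by (3.16) as printed, `eq316`). [cite: BalabanImbrieJaffe1988, (3.16) p.267] -/
theorem W0_add_two_V0_eq (e₀ : ℝ) (N : ℕ) (reu f : ℝ) :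
    W0 e₀ N reu f + 2 * V0 e₀ N f
      = e₀⁻¹ ^ 2 * (1 - reu) - (1 / 2) * f ^ 2
        - ∑ n ∈ Icc 2 N, (-1 : ℝ) ^ (n + 1) * e₀ ^ (2 * n - 2) * f ^ (2 * n) / ((2 * n).factorial : ℝ) := by
  have hs : ∑ n ∈ Icc 2 N, (-1 : ℝ) ^ (n + 1) * e₀ ^ (2 * n - 2) * f ^ (2 * n) / ((2 * n).factorial : ℝ)
      = -V0 e₀ N f := by
    unfold V0
    rw [← Finset.sum_neg_distrib]
    refine Finset.sum_congr rfl fun n _ => ?_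
    rw [pow_succ]
    ring
  rw [hs]
  unfold W0
  ring

/-- kernel: for `n̄/2 = N ≥ 1` and `e₀ ≠ 0`, `e₀⁻²(1 − Σ_{n=0}^{N} (−1)ⁿ(e₀f)^{2n}/(2n)!) = ½f² − V₀`, i.e. the corrected polynomial
part `½f² + Σ_{n=2}^{N} (−1)^{n+1} e₀^{2n−2}f^{2n}/(2n)!` of (3.16) is `e₀⁻²×`(1 − the Taylor polynomial of `cos` of degree `2N`
at `e₀f`). [cite: BalabanImbrieJaffe1988, (3.16) p.267] -/
theorem inv_sq_mul_one_sub_cosTaylor (e₀ : ℝ) (he : e₀ ≠ 0) (f : ℝ) (N : ℕ) (hN : 1 ≤ N) :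
    e₀⁻¹ ^ 2 * (1 - ∑ n ∈ range (N + 1), (-1 : ℝ) ^ n * (e₀ * f) ^ (2 * n) / ((2 * n).factorial : ℝ))
      = (1 / 2) * f ^ 2 - V0 e₀ N f := by
  induction N, hN using Nat.le_induction with
  | base =>
    rw [V0_of_le_one e₀ f le_rfl]
    simp only [Finset.sum_range_succ, Finset.sum_range_zero, zero_add, pow_zero, mul_zero, Nat.factorial_zero,
      Nat.cast_one, div_one, mul_one, pow_one]
    have h2 : ((2 * 1).factorial : ℝ) = 2 := by norm_num [Nat.factorial]
    rw [h2]
    field_simp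
    ring
  | succ N hN ih =>
    rw [Finset.sum_range_succ, V0_succ e₀ f hN, show 2 * (N + 1) - 2 = 2 * N by omega]
    have h3 : (e₀ * f) ^ (2 * (N + 1)) = e₀ ^ 2 * (e₀ ^ (2 * N) * f ^ (2 * (N + 1))) := by ring
    have h4 : e₀⁻¹ ^ 2 * ((-1 : ℝ) ^ (N + 1) * (e₀ * f) ^ (2 * (N + 1)) / ((2 * (N + 1)).factorial : ℝ))
        = (-1 : ℝ) ^ (N + 1) * e₀ ^ (2 * N) * f ^ (2 * (N + 1)) / ((2 * (N + 1)).factorial : ℝ) := by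
      rw [h3]
      field_simp
    linear_combination ih - h4

/-- kernel: for `n̄/2 = N ≥ 1`, `e₀ ≠ 0` and `Re u = cos(e₀f)`, the corrected remainder `W₀ + 2V₀` IS `e₀⁻²×`(the Taylor
polynomial of `cos` of degree `2N` at `e₀f` minus `cos e₀f`). [cite: BalabanImbrieJaffe1988, (3.16) p.267] -/
theorem W0_add_two_V0_cos_eq (e₀ : ℝ) (he : e₀ ≠ 0) (N : ℕ) (hN : 1 ≤ N) (f : ℝ) :
    W0 e₀ N (Real.cos (e₀ * f)) f + 2 * V0 e₀ N f
      = e₀⁻¹ ^ 2 * ((∑ n ∈ range (N + 1), (-1 : ℝ) ^ n * (e₀ * f) ^ (2 * n) / ((2 * n).factorial : ℝ))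
          - Real.cos (e₀ * f)) := by
  have key := inv_sq_mul_one_sub_cosTaylor e₀ he f N hN
  unfold W0
  linear_combination key

/-- **The p. 267 «irrelevant remainder» bound of (3.16), PROVED for the corrected sign.**  p. 267, verbatim: *"We consider the
expansion up to order n̄ in e₀ explicitly, the remainder is called 'irrelevant' because it is bounded by ce₀^{n̄}p(e₀)^{n̄+2} ≦
eε^{d+1} for n̄ large enough."* — typed reading: for `Re u(p) = cos(e₀f)` (`u(p) = e^{ie₀f}`, (3.15)), every real `f`, every
`e₀ ≠ 0` and every `n̄/2 = N ∈ ℕ`, the corrected remainder satisfies `|W₀ + 2V₀| ≤ e₀^{n̄}|f|^{n̄+2}/(n̄+2)!` (alternating Taylor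
bound of `cos`).  The printed-sign `W₀` alone does NOT satisfy such a bound (`W0_printed_sign_not_small`).
[cite: BalabanImbrieJaffe1988, (3.16) p.267] -/
theorem abs_W0_add_two_V0_le (e₀ : ℝ) (he : e₀ ≠ 0) (N : ℕ) (f : ℝ) :
    |W0 e₀ N (Real.cos (e₀ * f)) f + 2 * V0 e₀ N f|
      ≤ e₀ ^ (2 * N) * |f| ^ (2 * N + 2) / ((2 * N + 2).factorial : ℝ) := by
  rcases Nat.eq_zero_or_pos N with rfl | hN
  · -- `n̄ = 0`: `W₀ = e₀⁻²(1 − cos e₀f) − ½f² ∈ [−½f², 0]`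
    have hV : V0 e₀ 0 f = 0 := V0_of_le_one e₀ f (by norm_num)
    have h1 : 0 ≤ 1 - Real.cos (e₀ * f) := by linarith [Real.cos_le_one (e₀ * f)]
    have h2 : 1 - Real.cos (e₀ * f) ≤ (e₀ * f) ^ 2 / 2 := by
      have h := abs_cos_sub_taylor_le 0 (e₀ * f)
      simp only [zero_add, Finset.sum_range_one, pow_zero, mul_zero, Nat.factorial_zero, Nat.cast_one, div_one,
        mul_one] at h
      have h22 : ((2 : ℕ).factorial : ℝ) = 2 := by norm_num [Nat.factorial]
      rw [h22, sq_abs, abs_le] at h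
      linarith [h.1]
    have h0 : 0 ≤ e₀⁻¹ ^ 2 := sq_nonneg _
    have hy : e₀⁻¹ ^ 2 * (e₀ * f) ^ 2 = f ^ 2 := by field_simp
    have h02 : ((2 * 0 + 2).factorial : ℝ) = 2 := by norm_num [Nat.factorial]
    rw [hV, h02, mul_zero, pow_zero, one_mul, sq_abs]
    unfold W0
    rw [hV, abs_le]
    constructor
    · nlinarith [mul_nonneg h0 h1]
    · nlinarith [mul_le_mul_of_nonneg_left h2 h0]
  · rw [W0_add_two_V0_cos_eq e₀ he N hN f, abs_mul, abs_of_nonneg (sq_nonneg e₀⁻¹), abs_sub_comm]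
    have hb := abs_cos_sub_taylor_le N (e₀ * f)
    have heven : Even (2 * N + 2) := ⟨N + 1, by ring⟩
    calc e₀⁻¹ ^ 2 * |Real.cos (e₀ * f) - ∑ n ∈ range (N + 1), (-1 : ℝ) ^ n * (e₀ * f) ^ (2 * n) / ((2 * n).factorial : ℝ)|
        ≤ e₀⁻¹ ^ 2 * (|e₀ * f| ^ (2 * N + 2) / ((2 * N + 2).factorial : ℝ)) :=
          mul_le_mul_of_nonneg_left hb (sq_nonneg _)
      _ = e₀ ^ (2 * N) * |f| ^ (2 * N + 2) / ((2 * N + 2).factorial : ℝ) := by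
          rw [abs_mul, mul_pow, heven.pow_abs]
          have h5 : e₀ ^ (2 * N + 2) = e₀ ^ 2 * e₀ ^ (2 * N) := by ring
          rw [h5]
          field_simp

/-- **(3.16) remainder bound, explicit form** — the same statement with the corrected polynomial part displayed:
`|e₀⁻²(1 − cos e₀f) − ½f² − Σ_{n=2}^{N} (−1)^{n+1} e₀^{2n−2} f^{2n}/(2n)!| ≤ e₀^{2N}|f|^{2N+2}/(2N+2)!` (`N = n̄/2`, `e₀ ≠ 0`).
[cite: BalabanImbrieJaffe1988, (3.16) p.267] -/
theorem abs_remainder316_le (e₀ : ℝ) (he : e₀ ≠ 0) (N : ℕ) (f : ℝ) :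
    |e₀⁻¹ ^ 2 * (1 - Real.cos (e₀ * f)) - (1 / 2) * f ^ 2
        - ∑ n ∈ Icc 2 N, (-1 : ℝ) ^ (n + 1) * e₀ ^ (2 * n - 2) * f ^ (2 * n) / ((2 * n).factorial : ℝ)|
      ≤ e₀ ^ (2 * N) * |f| ^ (2 * N + 2) / ((2 * N + 2).factorial : ℝ) := by
  rw [← W0_add_two_V0_eq]
  exact abs_W0_add_two_V0_le e₀ he N f

/-- **(3.16) remainder bound in the printed shape** `c e₀^{n̄} p(e₀)^{n̄+2}`: under the small-field condition (3.15)
`|f^{(0)}(p)| ≤ p(e₀)`, the corrected remainder is `≤ (1/(n̄+2)!)·e₀^{n̄}·p(e₀)^{n̄+2} ≤ e₀^{n̄} p(e₀)^{n̄+2}` (so `c = 1` works;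
`n̄ = 2N`, `e₀ ≠ 0`). [cite: BalabanImbrieJaffe1988, (3.16) p.267] -/
theorem abs_W0_add_two_V0_le_of_smallField (e₀ : ℝ) (he : e₀ ≠ 0) (N : ℕ) {f p : ℝ} (hf : |f| ≤ p) :
    |W0 e₀ N (Real.cos (e₀ * f)) f + 2 * V0 e₀ N f| ≤ e₀ ^ (2 * N) * p ^ (2 * N + 2) := by
  have h := abs_W0_add_two_V0_le e₀ he N f
  have h1 : |f| ^ (2 * N + 2) ≤ p ^ (2 * N + 2) := pow_le_pow_left₀ (abs_nonneg f) hf _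
  have h2 : 0 ≤ e₀ ^ (2 * N) := by rw [pow_mul]; positivity
  have h3 : (1 : ℝ) ≤ ((2 * N + 2).factorial : ℝ) := by exact_mod_cast (2 * N + 2).factorial_pos
  have h4 : 0 ≤ p ^ (2 * N + 2) := le_trans (pow_nonneg (abs_nonneg f) _) h1
  calc |W0 e₀ N (Real.cos (e₀ * f)) f + 2 * V0 e₀ N f|
      ≤ e₀ ^ (2 * N) * |f| ^ (2 * N + 2) / ((2 * N + 2).factorial : ℝ) := h
    _ ≤ e₀ ^ (2 * N) * p ^ (2 * N + 2) / ((2 * N + 2).factorial : ℝ) := by gcongr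
    _ ≤ e₀ ^ (2 * N) * p ^ (2 * N + 2) := div_le_self (mul_nonneg h2 h4) h3

/-! ## The plaquette variable: `Re v = cos(e₀ f)` for `f = (ie₀)⁻¹ log v`, `|v| = 1` -/

/-- kernel (plumbing): `(ie₀)⁻¹ log v = −i e₀⁻¹ log v`. [cite: BalabanImbrieJaffe1988, (3.26) p.269] -/
private theorem fieldStrength_eq (e₀ : ℝ) (v : ℂ) :
    fieldStrength e₀ v = ((e₀⁻¹ : ℝ) : ℂ) * (-Complex.I) * Complex.log v := by
  unfold fieldStrength
  rw [mul_inv_rev, Complex.inv_I, Complex.ofReal_inv]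

/-- kernel: the real part of the field strength (3.26)/(3.15) `f = (ie₀)⁻¹ log v` is `e₀⁻¹ arg v` (principal branch).
[cite: BalabanImbrieJaffe1988, (3.26) p.269] -/
theorem fieldStrength_re (e₀ : ℝ) (v : ℂ) : (fieldStrength e₀ v).re = e₀⁻¹ * Complex.arg v := by
  rw [fieldStrength_eq]
  simp [Complex.mul_re, Complex.mul_im, Complex.ofReal_re, Complex.ofReal_im, Complex.neg_re,
    Complex.I_re, Complex.I_im, Complex.log_im]

/-- kernel: for `|v| = 1` the field strength `f = (ie₀)⁻¹ log v` is REAL (`Im f = −e₀⁻¹ log|v| = 0`).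
[cite: BalabanImbrieJaffe1988, (3.26) p.269] -/
theorem fieldStrength_im (e₀ : ℝ) (v : ℂ) (hv : ‖v‖ = 1) : (fieldStrength e₀ v).im = 0 := by
  rw [fieldStrength_eq]
  simp [Complex.mul_re, Complex.mul_im, Complex.ofReal_re, Complex.ofReal_im, Complex.neg_im,
    Complex.I_re, Complex.I_im, Complex.log_re, hv, Real.log_one]

/-- kernel: for a plaquette variable `v = u(p)` with `|v| = 1` and `e₀ ≠ 0`, `Re u(p) = cos(e₀ f^{(0)}(p))` with
`f^{(0)}(p) = (ie₀)⁻¹ log u(p)` ((3.15); principal branch) — the left side of (3.16) is `e₀⁻²(1 − cos e₀f)`.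
[cite: BalabanImbrieJaffe1988, (3.16) p.267] -/
theorem re_eq_cos_fieldStrength (e₀ : ℝ) (he : e₀ ≠ 0) (v : ℂ) (hv : ‖v‖ = 1) :
    v.re = Real.cos (e₀ * (fieldStrength e₀ v).re) := by
  have hv0 : v ≠ 0 := by
    rintro rfl
    simp at hv
  rw [fieldStrength_re, ← mul_assoc, mul_inv_cancel₀ he, one_mul, Complex.cos_arg hv0, hv, div_one]

/-- **(3.16) remainder bound for a plaquette variable**: for `|v| = 1`, `e₀ ≠ 0`, `f = f^{(0)} = Re (ie₀)⁻¹ log v` and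
`n̄/2 = N`, `|W₀ + 2V₀| ≤ e₀^{n̄}|f|^{n̄+2}/(n̄+2)!` with `Re u(p) = Re v`. [cite: BalabanImbrieJaffe1988, (3.16) p.267] -/
theorem abs_W0_add_two_V0_le_plaquette (e₀ : ℝ) (he : e₀ ≠ 0) (N : ℕ) (v : ℂ) (hv : ‖v‖ = 1) :
    |W0 e₀ N v.re (fieldStrength e₀ v).re + 2 * V0 e₀ N (fieldStrength e₀ v).re|
      ≤ e₀ ^ (2 * N) * |(fieldStrength e₀ v).re| ^ (2 * N + 2) / ((2 * N + 2).factorial : ℝ) := by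
  simpa only [← re_eq_cos_fieldStrength e₀ he v hv] using abs_W0_add_two_V0_le e₀ he N (fieldStrength e₀ v).re

/-! ## The printed sign `(−1)ⁿ` leaves `W₀` non-small (kernel witness) -/

/-- kernel witness, **the printed sign**: with `V₀` AS PRINTED (coefficient `(−1)ⁿ`), `W₀ = (corrected remainder) − 2V₀` contains
the non-small term `−2·e₀²f⁴/4!`; quantitatively, for `n̄/2 = 2`, `f = 1` and `0 < e₀ ≤ 1`: `W₀ ≤ −(59/720)e₀²`
(`= −e₀²/12 + e₀⁴/720` at worst). [cite: BalabanImbrieJaffe1988, (3.16) p.267] -/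
theorem W0_printed_le (e₀ : ℝ) (he0 : 0 < e₀) (he1 : e₀ ≤ 1) :
    W0 e₀ 2 (Real.cos e₀) 1 ≤ -(59 / 720) * e₀ ^ 2 := by
  have h := abs_W0_add_two_V0_le e₀ he0.ne' 2 1
  have h6 : ((2 * 2 + 2).factorial : ℝ) = 720 := by norm_num [Nat.factorial]
  rw [h6, V0_two, show (2 * 2 : ℕ) = 4 from rfl] at h
  simp only [abs_one, one_pow, mul_one, abs_le] at h
  have h4 : e₀ ^ 4 ≤ e₀ ^ 2 := pow_le_pow_of_le_one he0.le he1 (by norm_num)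
  linarith [h.2]

/-- **The printed sign is a slip (kernel witness of non-smallness).**  With `V₀` AS PRINTED in (3.16) (`(−1)ⁿ`), the remainder
`W₀` is NOT *"bounded by ce₀^{n̄}p(e₀)^{n̄+2}"*: already for `n̄ = 4` there is no constant `c` with `|W₀| ≤ c e₀⁴|f|⁶` on the
small-field set `{0 < e₀ ≤ 1, |f| ≤ 1}` (`W₀ ≍ −e₀²f⁴/12` there).  The bound holds for the corrected sign `(−1)^{n+1}`
(`abs_W0_add_two_V0_le`). [cite: BalabanImbrieJaffe1988, (3.16) p.267] -/
theorem W0_printed_sign_not_small :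
    ¬ ∃ c : ℝ, ∀ e₀ f : ℝ, 0 < e₀ → e₀ ≤ 1 → |f| ≤ 1 →
      |W0 e₀ 2 (Real.cos (e₀ * f)) f| ≤ c * e₀ ^ 4 * |f| ^ 6 := by
  rintro ⟨c, hc⟩
  have hc0 : 0 < |c| + 1 := by positivity
  set e₀ : ℝ := 1 / (4 * (|c| + 1)) with he
  have he0 : 0 < e₀ := by positivity
  have hee : e₀ * (|c| + 1) = 1 / 4 := by rw [he]; field_simp
  have he4 : e₀ ≤ 1 / 4 := by nlinarith [abs_nonneg c]
  have he1 : e₀ ≤ 1 := by linarith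
  have h1 := hc e₀ 1 he0 he1 (by simp)
  simp only [abs_one, one_pow, mul_one] at h1
  have h2 := W0_printed_le e₀ he0 he1
  have h3 : (59 / 720) * e₀ ^ 2 ≤ c * e₀ ^ 4 := by
    have := neg_le_abs (W0 e₀ 2 (Real.cos e₀) 1)
    linarith
  have h4 : c * e₀ ^ 4 ≤ |c| * e₀ ^ 4 := by nlinarith [le_abs_self c, pow_nonneg he0.le 4]
  have h5 : |c| * e₀ ^ 2 ≤ 1 / 16 := by
    have : |c| * e₀ ≤ 1 / 4 := by nlinarith [abs_nonneg c]
    nlinarith [abs_nonneg c]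
  have h7 : |c| * e₀ ^ 4 ≤ (1 / 16) * e₀ ^ 2 := by
    rw [show e₀ ^ 4 = e₀ ^ 2 * e₀ ^ 2 by ring]
    nlinarith [pow_nonneg he0.le 2]
  have h9 : (59 / 720 : ℝ) ≤ 1 / 16 := le_of_mul_le_mul_right (h3.trans (h4.trans h7)) (pow_pos he0 2)
  norm_num at h9

/-! ## v1.1 (append-only): the bounds restated for the file-of-record decl `W0corr` (`BIJ88Sect3Statements` v1.2, r18),
whose `abs_W0corr_le` assumes `0 < e₀`, `1 ≤ nhalf`, `e₀|f| ≤ 1`; since `W₀^{corr} = W₀ + 2V₀` (`W0_printed_eq`) the theorems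
above drop the smallness hypothesis and give the sharp constant `1/(n̄+2)!`. -/

/-- kernel: **the alternating Taylor bound for `cos`, all real `θ`**: `|cos θ − Σ_{n=0}^{N} (−1)ⁿθ^{2n}/(2n)!| ≤ |θ|^{2N+2}/(2N+2)!`
(the estimate behind p. 267's bound; cf. `BIJ88Sect3Statements.cos_taylor_remainder`: `|θ| ≤ 1`, constant `1`). [cite: BalabanImbrieJaffe1988, (3.16) p.267] -/
theorem cos_taylor_remainder_sharp (θ : ℝ) (N : ℕ) :
    |Real.cos θ - ∑ n ∈ range (N + 1), (-1 : ℝ) ^ n * θ ^ (2 * n) / ((2 * n).factorial : ℝ)|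
      ≤ |θ| ^ (2 * N + 2) / ((2 * N + 2).factorial : ℝ) :=
  abs_cos_sub_taylor_le N θ

/-- **(3.16) remainder bound for the file-of-record decl `W0corr`, no smallness hypothesis**: for every `e₀ ≠ 0`, `nhalf = N ∈ ℕ`
and real `f`, `|W₀^{corr}| ≤ e₀^{2N}|f|^{2N+2}/(2N+2)!` (drops `e₀|f| ≤ 1`, `1 ≤ nhalf` of `abs_W0corr_le`). [cite: BalabanImbrieJaffe1988, (3.16) p.267] -/
theorem abs_W0corr_le_sharp (e₀ : ℝ) (he : e₀ ≠ 0) (N : ℕ) (f : ℝ) :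
    |W0corr e₀ N f| ≤ e₀ ^ (2 * N) * |f| ^ (2 * N + 2) / ((2 * N + 2).factorial : ℝ) := by
  simpa only [W0_printed_eq, sub_add_cancel] using abs_W0_add_two_V0_le e₀ he N f

/-- **(3.16) remainder bound in the paper's letters, no hypothesis on `e₀p(e₀)`**: under (3.15) `|f^{(0)}(p)| ≤ p(e₀)`,
`|W₀^{corr}(p)| ≤ e₀^{n̄}p(e₀)^{n̄+2}` (`c = 1`; every `e₀ ≠ 0`, `n̄ = 2N`; cf. `abs_W0corr_le_printed`). [cite: BalabanImbrieJaffe1988, (3.16) p.267] -/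
theorem abs_W0corr_le_printed_sharp (e₀ : ℝ) (he : e₀ ≠ 0) (N : ℕ) {f pe₀ : ℝ} (hf : |f| ≤ pe₀) :
    |W0corr e₀ N f| ≤ e₀ ^ (2 * N) * pe₀ ^ (2 * N + 2) := by
  simpa only [W0_printed_eq, sub_add_cancel] using abs_W0_add_two_V0_le_of_smallField e₀ he N hf

end Literature.MathematicalPhysics.QuantumFieldTheory.BalabanImbrieJaffe1984to88.BIJ88W0Remainder
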